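import Summits.QuantumAdvantage.QuantumAdvantage.Theorems.SosSandwichTransferPBQueryCrux
import HarnessLib

/-!
# Aaronson–Ambainis Thm. 23 (query half) needs only the AA conjecture for quantum QUERY algorithms

Support theorem for route `SosSandwich` (crux `PseudoBoundedAA`, stmt-QuantumAdvantage-15237; calibration of the route's
analytic crux after `Theorems/SosSandwichTransferPBQueryCrux.lean`).  The Literature file
`AaronsonAmbainisThm23Queries.lean` proves the query-efficient half of Aaronson–Ambainis' Thm. 23 — for every oracle
circuit family `F` and input `x` the EXPLICIT simulation tree `simTreeOn c C₀ F x` over the relevant oracle bits has depth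
`poly(size + n)` and `Pr_A[|p̃_x(A) − p_x(A)| > 1/10] < 1/n³` — under the FULL Aaronson–Ambainis conjecture (all bounded
polynomials of degree `d`).  Here the same three statements are derived from `AA_Q` alone (the conjecture for acceptance
probabilities of quantum query algorithms, inline as in `QueryRestrict.quantumQuerySimulable_of_aaQuery`):

* `simTreeOn_depth_error_le_of_aaQuery` — the depth / bad-pattern bounds of `simTreeOn_depth_error_le`;
* `measure_simTreeOn_deviation_lt_of_aaQuery` — `μ {A : |p̃_x(A) − p_x(A)| > 1/10} < 1/n³`;
* `thm23_queries_of_aaQuery` — the packaged `∃ C k, ∀ F x, ∃` tree of depth `≤ C (size + n)^k …`.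

Mechanism: Aaronson–Ambainis' tree only ever asks for influential variables of RESTRICTIONS of `p_x = acceptPoly F x`; by the
circuit→query bridge (`CircuitToQuery.exists_queryAlg_acceptPoly`) `p_x` is the acceptance probability of a query algorithm
with `q = #oracle gates` queries, and restrictions stay in that class (`QueryRestrict.restrictAlg_acceptProb`), so the
restriction-closed-class form of Thm. 21 (`SimTreePB.simTree_depth_error_le_of_inv`) applies with the invariant
"cube values of some `q`-query algorithm"; degenerate cases (`0` relevant bits, `0` oracle gates) have variance `0`.
Honest label: calibration (which analytic hypothesis the random-oracle simulation really uses); nothing is proved about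
`AA_Q` itself.  No named fact; axioms standard.
Sources: AaronsonAmbainis2014 Thm. 21, Thm. 23 (proof, p. 14), Lemma 20; BealsEtAl2001 §2.
-/

noncomputable section
-- D-0017: single-conjunct summit ⇒ the duplicate `QuantumAdvantage.QuantumAdvantage` is mandated.
set_option linter.dupNamespace false

namespace Summit.QuantumAdvantage.QuantumAdvantage.Theorems.SosSandwich.QueryCrux

open Finset MeasureTheory Literature.Computability.Cryptography Literature.Computability.QuantumComplexity
  Literature.Computability.QuantumComplexity.ClassicalSimulation
open Summit.QuantumAdvantage.QuantumAdvantage.Cruxes.TransferPB.Birth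
open Summit.QuantumAdvantage.QuantumAdvantage.Theorems.SosSandwich.QueryRestrict (restrictAlg restrictAlg_acceptProb)
open scoped ENNReal

variable {G : QGateSet} {c : ℕ} {C₀ : ℝ}

/-- **The explicit bounds for `simTreeOn` from `AA_Q`**: depth `≤ (⌈16·4^c/C₀⌉ + 1) · 61^{4c+2} · (size + n)^{4(4c+2)}` and
`#{b : |tree(b) − p_x(b)| > 1/10} ≤ δ 2^M`, for constants `c, C₀` satisfying the Aaronson–Ambainis bound for quantum QUERY
acceptance probabilities only (twin of `simTreeOn_depth_error_le`, whose hypothesis is the bound for all bounded degree-`d`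
polynomials). [cite: AaronsonAmbainis2014, Thm. 23 (proof, p. 14) via Thm. 21] -/
theorem simTreeOn_depth_error_le_of_aaQuery (hC₀ : 0 < C₀)
    (H : ∀ (N : ℕ) (Q : QQueryAlg N) (p : MvPolynomial (Fin N) ℝ) (ε : ℝ),
      1 ≤ Q.queries → (∀ x, evalBool p x = Q.acceptProb x) → 0 < ε → ε ≤ boolVariance p →
        ∃ i : Fin N, C₀ * (ε / Q.queries) ^ c ≤ influence i p)
    (hG : G.IsUnitary) (F : QCircuitFamily G) (x : List Bool) (hn : 1 ≤ x.length) :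
    ((simTreeOn c C₀ F x).depth : ℝ) ≤
        ((Nat.ceil (16 * 2 ^ c * 2 ^ c / C₀) + 1 : ℕ) : ℝ) * 61 ^ (4 * c + 2) *
          (((F.circ x.length).size : ℝ) + x.length) ^ (4 * (4 * c + 2)) ∧
      ((univ.filter fun b : Fin (numOracleBits F x) → Bool =>
          1 / 10 < |(simTreeOn c C₀ F x).eval b - evalBool (acceptPoly F x) b|).card : ℝ) ≤
        thm23Delta x * 2 ^ numOracleBits F x := by
  have hd1 : 1 ≤ thm23Degree F x := by unfold thm23Degree; omega
  have hdeg : (acceptPoly F x).totalDegree ≤ thm23Degree F x :=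
    (totalDegree_acceptPoly_le F x).trans (by unfold thm23Degree; omega)
  -- the invariant class: cube values of SOME algorithm with `#oracle gates` queries (vacuous over `0` bits)
  let K : MvPolynomial (Fin (numOracleBits F x)) ℝ → Prop := fun q => 0 < numOracleBits F x →
    ∃ Q' : QQueryAlg (numOracleBits F x), Q'.queries = (F.circ x.length).oracleQueries ∧ ∀ b, evalBool q b = Q'.acceptProb b
  have hK : ∀ (q : MvPolynomial (Fin (numOracleBits F x)) ℝ) (i : Fin (numOracleBits F x)) (b : Bool),
      K q → K (restrictPoly i b q) := by
    intro q i b hq hN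
    obtain ⟨Q', hQ', hq'⟩ := hq hN
    exact ⟨restrictAlg Q' i b, hQ', fun y => by rw [evalBool_restrictPoly, hq', restrictAlg_acceptProb]⟩
  have hH : ∀ (q : MvPolynomial (Fin (numOracleBits F x)) ℝ) (ε' : ℝ), K q → q.totalDegree ≤ thm23Degree F x →
      (∀ y, 0 ≤ evalBool q y ∧ evalBool q y ≤ 1) → 0 < ε' → ε' ≤ boolVariance q →
        ∃ i : Fin (numOracleBits F x), C₀ * (ε' / (thm23Degree F x : ℕ)) ^ c ≤ influence i q := by
    intro q ε' hq _ _ hε' hv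
    rcases Nat.eq_zero_or_pos (numOracleBits F x) with hN0 | hN
    · exfalso
      rw [boolVariance_eq_zero_of_eq_zero hN0] at hv
      exact absurd hv (not_le.2 hε')
    obtain ⟨Q', hQ', hq'⟩ := hq hN
    rcases Nat.eq_zero_or_pos (F.circ x.length).oracleQueries with hq0 | hqpos
    · exfalso
      have hv0 : boolVariance q = 0 := boolVariance_eq_zero_of_forall_eq fun a b => by
        rw [hq', hq']
        exact PBAAQuerySimulable.acceptProb_const_of_queries_eq_zero Q' (by rw [hQ', hq0]) a b
      rw [hv0] at hv
      exact absurd hv (not_le.2 hε')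
    obtain ⟨i, hi⟩ := H _ Q' q ε' (by rw [hQ']; exact hqpos) hq' hε' hv
    refine ⟨i, le_trans ?_ hi⟩
    rw [hQ']
    have hqR : (0 : ℝ) < (F.circ x.length).oracleQueries := by exact_mod_cast hqpos
    unfold thm23Degree
    gcongr
    · linarith
  have hKp : K (acceptPoly F x) := fun hN => CircuitToQuery.exists_queryAlg_acceptPoly F x hG hN
  obtain ⟨hdepth, herr⟩ := SimTreePB.simTree_depth_error_le_of_inv hC₀ hd1 hK hH hKp hdeg
    (acceptPoly_bounded F x hG) (by norm_num : (0 : ℝ) < 1 / 10) (by norm_num) (thm23Delta_pos hn)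
    (thm23Delta_le_one hn)
  refine ⟨?_, herr⟩
  refine hdepth.trans ?_
  have hoq : (F.circ x.length).oracleQueries ≤ (F.circ x.length).size := QCircuit.oracleQueries_le_size _
  have hbase : ((thm23Degree F x : ℕ) : ℝ) / (1 / 10 * thm23Delta x) + 1 ≤
      61 * (((F.circ x.length).size : ℝ) + x.length) ^ 4 := by
    have hn' : (0 : ℝ) < x.length := by exact_mod_cast hn
    have e1 : ((thm23Degree F x : ℕ) : ℝ) / (1 / 10 * thm23Delta x) =
        20 * (x.length : ℝ) ^ 3 * (thm23Degree F x : ℕ) := by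
      unfold thm23Delta; field_simp; ring
    rw [e1]
    unfold thm23Degree
    push_cast
    calc (20 : ℝ) * (x.length : ℝ) ^ 3 * (2 * ((F.circ x.length).oracleQueries : ℝ) + 1) + 1
        ≤ 20 * (x.length : ℝ) ^ 3 * (2 * ((F.circ x.length).size : ℝ) + 1) + 1 := by gcongr
      _ ≤ 61 * (((F.circ x.length).size : ℝ) + x.length) ^ 4 := thm23_depth_arith hn
  have hnn : (0 : ℝ) ≤ ((thm23Degree F x : ℕ) : ℝ) / (1 / 10 * thm23Delta x) + 1 := by
    have := thm23Delta_pos hn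
    positivity
  calc (((Nat.ceil (16 * 2 ^ c * 2 ^ c / C₀) + 1 : ℕ) : ℝ)) *
        (((thm23Degree F x : ℕ) : ℝ) / (1 / 10 * thm23Delta x) + 1) ^ (4 * c + 2)
      ≤ ((Nat.ceil (16 * 2 ^ c * 2 ^ c / C₀) + 1 : ℕ) : ℝ) *
          (61 * (((F.circ x.length).size : ℝ) + x.length) ^ 4) ^ (4 * c + 2) := by gcongr
    _ = ((Nat.ceil (16 * 2 ^ c * 2 ^ c / C₀) + 1 : ℕ) : ℝ) * 61 ^ (4 * c + 2) *
          (((F.circ x.length).size : ℝ) + x.length) ^ (4 * (4 * c + 2)) := by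
        rw [mul_pow, ← pow_mul]; ring

/-- **`Pr_A[|p̃_x(A) − p_x(A)| > 1/10] < 1/n³` for the explicit tree `simTreeOn`, from `AA_Q`** (twin of
`measure_simTreeOn_deviation_lt`). [cite: AaronsonAmbainis2014, Thm. 23 (proof, p. 14: claim (apx))] -/
theorem measure_simTreeOn_deviation_lt_of_aaQuery (hC₀ : 0 < C₀)
    (H : ∀ (N : ℕ) (Q : QQueryAlg N) (p : MvPolynomial (Fin N) ℝ) (ε : ℝ),
      1 ≤ Q.queries → (∀ x, evalBool p x = Q.acceptProb x) → 0 < ε → ε ≤ boolVariance p →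
        ∃ i : Fin N, C₀ * (ε / Q.queries) ^ c ≤ influence i p)
    (hG : G.IsUnitary) (F : QCircuitFamily G) (x : List Bool) (hn : 1 ≤ x.length) :
    randomOracleMeasure {A : Set (List Bool) |
        1 / 10 < |(simTreeOn c C₀ F x).eval (oracleBits F x A) - F.acceptProbOn A x|} <
      ENNReal.ofReal (1 / (x.length : ℝ) ^ 3) := by
  classical
  obtain ⟨-, herr⟩ := simTreeOn_depth_error_le_of_aaQuery hC₀ H hG F x hn
  set t := simTreeOn c C₀ F x with ht
  have hset : {A : Set (List Bool) | 1 / 10 < |t.eval (oracleBits F x A) - F.acceptProbOn A x|} =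
      {A : Set (List Bool) |
        oracleBits F x A ∈ univ.filter fun b => 1 / 10 < |t.eval b - evalBool (acceptPoly F x) b|} := by
    ext A
    simp only [Set.mem_setOf_eq, mem_filter, mem_univ, true_and, evalBool_acceptPoly]
  rw [hset, randomOracleMeasure_oracleBits_mem]
  set S := univ.filter fun b : Fin (numOracleBits F x) → Bool =>
    1 / 10 < |t.eval b - evalBool (acceptPoly F x) b| with hS
  have hcard : (S.card : ℝ) ≤ thm23Delta x * 2 ^ numOracleBits F x := herr
  have hmeas : (S.card : ℝ≥0∞) * 2⁻¹ ^ numOracleBits F x =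
      ENNReal.ofReal ((S.card : ℝ) / 2 ^ numOracleBits F x) := by
    rw [ENNReal.ofReal_div_of_pos (by positivity), ENNReal.ofReal_natCast, ENNReal.ofReal_pow (by norm_num),
      ENNReal.ofReal_ofNat, ← ENNReal.inv_pow, div_eq_mul_inv]
  have hn' : (0 : ℝ) < x.length := by exact_mod_cast hn
  rw [hmeas, ENNReal.ofReal_lt_ofReal_iff (by positivity)]
  calc (S.card : ℝ) / 2 ^ numOracleBits F x ≤ thm23Delta x := by
        rw [div_le_iff₀ (by positivity)]; exact hcard
    _ < 1 / (x.length : ℝ) ^ 3 := thm23Delta_lt hn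

/-- **Aaronson–Ambainis Thm. 23, query half, from `AA_Q`**: if the Aaronson–Ambainis influence bound holds for the acceptance
probabilities of quantum QUERY algorithms, then for every circuit family `F` over a unitary gate set (with oracle gates) and
every input `x` of length `n ≥ 1` there is a deterministic decision tree over the `M` relevant oracle bits (`simTreeOn`), of
depth `≤ C (size(F.circ n) + n)^k`, with `Pr_A[|p̃_x(A) − p_x(A)| > 1/10] < 1/n³` for the random oracle `A` (twin of
`aaronsonAmbainis2014_thm23_queries`, which assumes the full conjecture). [cite: AaronsonAmbainis2014, Thm. 23 (proof, p. 14)] -/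
theorem thm23_queries_of_aaQuery
    (hAAQ : ∃ (c : ℕ) (C : ℝ), 0 < C ∧ ∀ (N : ℕ) (Q : QQueryAlg N) (p : MvPolynomial (Fin N) ℝ) (ε : ℝ),
      1 ≤ Q.queries → (∀ x, evalBool p x = Q.acceptProb x) → 0 < ε → ε ≤ boolVariance p →
        ∃ i : Fin N, C * (ε / Q.queries) ^ c ≤ influence i p)
    (hG : G.IsUnitary) :
    ∃ C k : ℕ, ∀ (F : QCircuitFamily G) (x : List Bool), 1 ≤ x.length →
      ∃ t : RealDecisionTree (numOracleBits F x),
        (t.depth : ℝ) ≤ C * (((F.circ x.length).size : ℝ) + x.length) ^ k ∧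
        randomOracleMeasure {A : Set (List Bool) |
            1 / 10 < |t.eval (oracleBits F x A) - F.acceptProbOn A x|} <
          ENNReal.ofReal (1 / (x.length : ℝ) ^ 3) := by
  obtain ⟨c, C₀, hC₀, H⟩ := hAAQ
  refine ⟨(Nat.ceil (16 * 2 ^ c * 2 ^ c / C₀) + 1) * 61 ^ (4 * c + 2), 4 * (4 * c + 2),
    fun F x hn => ⟨simTreeOn c C₀ F x, ?_, measure_simTreeOn_deviation_lt_of_aaQuery hC₀ H hG F x hn⟩⟩
  have h := (simTreeOn_depth_error_le_of_aaQuery hC₀ H hG F x hn).1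
  push_cast at h ⊢
  linarith

end Summit.QuantumAdvantage.QuantumAdvantage.Theorems.SosSandwich.QueryCrux
end
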